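import Summits.SmoothPoincare4.SmoothPoincare4.Theses.EntropyRung
import Summits.SmoothPoincare4.SmoothPoincare4.Theorems.EntropyRungRecognitionOfShrinkerGaps
import Summits.SmoothPoincare4.SmoothPoincare4.Theorems.EntropyRungSubcylindricalRecognitionSingularFlow
import Summits.SmoothPoincare4.SmoothPoincare4.Theorems.EntropyRungSubcylindricalRecognitionPointPicking
import Summits.SmoothPoincare4.SmoothPoincare4.Theorems.EntropyRungSubcylindricalRecognitionRescaledSequence
import Summits.SmoothPoincare4.SmoothPoincare4.Theorems.EntropyRungSubcylindricalRecognitionCompactModelRecognition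
import Literature.Geometry.Riemannian.BamlerTangentFlowAtInfinity
import Literature.Geometry.Riemannian.BamlerEpsilonRegularity
import Literature.Geometry.Riemannian.BamlerFCompactness
import Literature.Geometry.Riemannian.BamlerFCompactnessAssembly
import Literature.Geometry.Riemannian.BamlerFCompactnessAssemblyCompact
import Literature.Geometry.Riemannian.MetricFlowFTotalBoundedness
import Literature.Geometry.Riemannian.MetricFlowFiniteTimeSubconvergence
import Literature.Geometry.Riemannian.MetricFlowKernelSubconvergence
import Literature.Geometry.Riemannian.MetricFlowFCompleteness
import Literature.Geometry.Riemannian.MetricFlowFLimitPair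
import Literature.Geometry.Riemannian.MetricFlowFLimitWithin
import Literature.Geometry.Riemannian.RicciFlowShortTimeProofs
import Literature.Geometry.Riemannian.PerelmanEntropyMonotonicityProofs
import Literature.Topology.FourManifolds.HomotopyS4CompactProofs
import HarnessLib
import HarnessLib.Audit

/-!
# Line `ancient-sphere-rigidity` for crux `EntropyRung.SubcylindricalRecognition` (stmt-SmoothPoincare4-10869)

Skeleton **r8** (fourth lead c1, 2026-08-16; re-owned unchanged by the ninth lead prover-line-stmt-SmoothPoincare4-10869-c6-0, 2026-08-17) of the line
**type-agnostic blow-up, Bamler blow-down at `-∞`, cone-point exclusion on the compact approximants, density gaps**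
(r5–r7: third lead; r4: gen-1 lead; r2/r3: gen-0 lead; round-1 skeleton: planner).

## Status r12 (lead c7, 2026-08-17T16:20Z) — TWO sorries: 2a (ε-regularity) and 2c (structure export). Stub 2b `stub_FCompactness : bamler_FCompactness_ricciFlow` is PROVED (Bamler 2023 Cor 7.5 for Ricci flows, J = ∅): total boundedness (2b-TB: p168498 p168620 p168499, record p168868) + completeness (2b-CP: p167054 over Lemma 5.20 = 2b-L: p170080 p170118, record p170240) + assembly p167089; ≈ 40 Literature files landed by this seat, 0 named facts.

(r11: THREE sorries 2a, 2b-L, 2c; 2b-TB closed)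

(r10: FOUR sorries 2a, 2b-TB, 2b-CP, 2c; stub 2b DERIVED from 2b-TB + 2b-CP (p162151))

(r9: THREE sorries (milestone stubs 2a–2c), whose composition is the named published fact N1; r8 had ONE sorry = N1)

* `stub_singularFlow` — **CLOSED, unconditionally** (new in r8): its conditional form `stub_singularFlow_of`
  (Theorems/EntropyRungSubcylindricalRecognitionSingularFlow.lean, p72410) applied to the two DISCHARGED named facts
  F1 `Literature.Geometry.Riemannian.ricciFlow_shortTime_existence_holds` (RicciFlowShortTimeProofs.lean, Hamilton 1982
  Thm. 4.2 via DeTurck) and F2 `Literature.Geometry.Riemannian.perelman_muEntropy_monotone_holds`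
  (PerelmanEntropyMonotonicityProofs.lean, Perelman 2002 (3.4)); landed stand-alone as
  Theorems/EntropyRungSubcylindricalRecognitionSingularFlowHolds.lean (p96404).
* `stub_epsilonRegularity`, `stub_FCompactness`, `stub_structureExport` — OPEN (r9 milestone stubs); their composition
  `orbifoldTangentFlow_of_stubs` = the named fact N1 (formerly the single stub `stub_orbifoldTangentFlow`)
  `Literature.Geometry.Riemannian.bamler_orbifoldTangentFlowAtInfinity_four` VERBATIM (BamlerTangentFlowAtInfinity.lean,
  landed p77087, no `_holds`): Bamler 2020a Prop. 5.2 / Thm. 10.1, 2020b, 2020c Thms. 2.4, 2.9, 2.16, 2.40, 2.46 exported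
  in smooth vocabulary. These three are the only `sorry`s of the file.
* Everything else is LANDED and used below BY NAME: `stub_pointPicking` (p71490), `stub_rescaledSequence` (p71836),
  `stub_compactModelRecognition` (p72507), `stub_renormalise` (p74584), `stub_muEntropyTestFunction` (p76729),
  `stub_multiplicityLintegral` (p76657), `stub_injOnVolumeComparison` (p77740), `stub_coneAnnulusArithmetic` (p84300),
  the lead glue `coneCore` (p86535) / `stub_blowdownSoliton_of` (p95808), and the assembled blow-down
  `RecognitionOfShrinkerGaps.blowdown_of : N1 → <r2 stub_blowdown>` (Theorems/EntropyRungRecognitionOfShrinkerGaps.lean,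
  p91718), whose cone branch is the fact-free exclusion of orbifold points of order `k ≥ 2` on the COMPACT approximants
  (Γ-invariant Gaussian annulus test function: `μ(Q g_k(t), τ) ≤ -log k + o(1) < ν_cyl + δ'` against the floor).

So the crux closes from its two declared route dependencies `NoncompactShrinkerGap` (#2), `CompactShrinkerGap` (#4)
MODULO EXACTLY N1; equivalently the glue item `RecognitionOfShrinkerGaps` (stmt-14742) is N1 away from closing
(`recognitionOfShrinkerGaps_of_bamler`, Theorems/EntropyRungSubcylindricalRecognitionOfBamler.lean, this lead).

Chain: `(M, g₀)` closed, `M ≃ₕ S⁴`, `R > 0`, `ν > ν_cyl`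
  —[stub_singularFlow ✓]→ maximal flow, `T < ∞`, blow-up, `κ`-NLC, floor `μ ≥ ν_cyl + δ`
  —[stub_pointPicking ✓]→ `(x_k, t_k, Q_k)` —[stub_rescaledSequence ✓]→ flows on `M × [-A_k, 0]`, `|Rm| ≤ 1`,
  `|Rm|(x_k,0) ≥ c`, floor —[orbifoldTangentFlow_of_stubs = N1 ⇐ stubs 2a–2c]→ orbifold shrinker export
  —[coneCore ✓, stub_renormalise ✓; RecognitionOfShrinkerGaps.blowdown_of ✓]→ complete smooth normalised shrinker `S`,
  `∫ e^{-f} > 32π²√π e^{-3/2}`, `R ≢ 0`, compact ⇒ injective immersion `S → M`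
  —[stub_compactModelRecognition ✓; #2; #4]→ `M ≃ₘ S⁴`.

Disproof.lean (cdisprove cycle 3) honoured: `recognitionWithoutHomotopyEquiv_false` — the homotopy equivalence is consumed
twice in `SubcylindricalRecognition_of` (connectedness of `M`; `S ≃ₕ S⁴` for #4); §8.2 (floor ⇒ NLC) — the NLC clause of the
blow-up sequence is carried but not consumed by N1; §8 Targets: no `<stub>_false`.
-/

noncomputable section

open scoped Manifold ContDiff Topology ENNReal NNReal ContinuousMap
open Set MeasureTheory Filter
open Literature.Geometry.Lorentzian Literature.Geometry.Riemannian

namespace Summit.SmoothPoincare4.SmoothPoincare4.Cruxes.SubcylindricalRecognition.AncientSphereRigidity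

/-! ## Stub 1a — the singular flow with Perelman's floor: CLOSED (r8) -/

/-- **Stub 1a** (Hamilton 1982; Perelman 2002 §3.1, §4) — CLOSED unconditionally: `stub_singularFlow_of` (p72410) at the
discharged facts `ricciFlow_shortTime_existence_holds`, `perelman_muEntropy_monotone_holds`. Registered signature unchanged
since r2. [cite: Hamilton1982, Thm. 4.2] [cite: Perelman2002, §3.1, (3.4); §4, Thm. 4.1] -/
theorem stub_singularFlow :
    ∀ (M : Type) [TopologicalSpace M] [T2Space M] [SecondCountableTopology M]
      [ChartedSpace (EuclideanSpace ℝ (Fin 4)) M] [IsManifold (𝓡 4) ∞ M] [CompactSpace M]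
      [ConnectedSpace M] [T3Space M] [MeasurableSpace M] [BorelSpace M]
      (g₀ : PseudoRiemannianMetric (𝓡 4) ∞ (EuclideanSpace ℝ (Fin 4)) (TangentSpace (𝓡 4) : M → Type _))
      [g₀.HasLeviCivita] (hg₀ : g₀.IsRiemannian),
      (∀ x : M, 0 < g₀.scalarCurvature x) →
      ∀ δ : ℝ, 0 < δ →
      (∀ τ : ℝ, 0 < τ → ∀ f : M → ℝ, ContMDiff (𝓡 4) 𝓘(ℝ, ℝ) ∞ f →
        ∫ x, (4 * Real.pi * τ) ^ (-(4 : ℝ) / 2) * Real.exp (-f x)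
          ∂(riemannianMeasure (g₀.toContMDiffRiemannianMetric hg₀)) = 1 →
        Real.log 2 + Real.log Real.pi / 2 - 3 / 2 + δ ≤
          ∫ x, (τ * (g₀.scalarCurvature x + g₀.gradSq f x) + f x - 4) *
            ((4 * Real.pi * τ) ^ (-(4 : ℝ) / 2) * Real.exp (-f x))
            ∂(riemannianMeasure (g₀.toContMDiffRiemannianMetric hg₀))) →
      ∃ (T κ : ℝ), 0 < κ ∧
        ∃ (g : ℝ → PseudoRiemannianMetric (𝓡 4) ∞ (EuclideanSpace ℝ (Fin 4)) (TangentSpace (𝓡 4) : M → Type _))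
          (cov : ℝ → CovariantDerivative (𝓡 4) (EuclideanSpace ℝ (Fin 4)) (TangentSpace (𝓡 4) : M → Type _)),
          IsMaximalRicciFlow g cov T ∧ g 0 = g₀ ∧
          (∀ C : ℝ, ∃ t₀ ∈ Set.Ico 0 T, ∀ t ∈ Set.Ico t₀ T, ¬ CurvatureBoundedBy (g t) (cov t) C) ∧
          (∀ r₀ : ℝ, 0 < r₀ → r₀ < Real.sqrt T → IsKappaNoncollapsed g cov (Set.Ico 0 T) κ r₀) ∧
          (∀ t ∈ Set.Ico 0 T, ∀ τ : ℝ, 0 < τ →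
            ((Real.log 2 + Real.log Real.pi / 2 - 3 / 2 + δ : ℝ) : EReal) ≤
              (g t).muEntropy (cov t) τ) :=
  _root_.Summit.SmoothPoincare4.SmoothPoincare4.Theorems.SubcylindricalRecognition.AncientSphereRigidity.stub_singularFlow_of
    ricciFlow_shortTime_existence_holds perelman_muEntropy_monotone_holds

/-! ## Stubs 1b, 1c — point picking, parabolic rescaling: CLOSED (p71490, p71836; used below by name). -/

/-! ## Stubs 2a–2c (r9 milestone reshape) — the three named pieces of N1

N1 = `bamler_orbifoldTangentFlowAtInfinity_four` is now DERIVED from three registered stubs named after Bamler's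
theorems (strategist census D3): the ε-regularity theorem of 2020a (`stub_epsilonRegularity` = the typed fact
`bamler_epsilonRegularity`, Thm 10.2; its Layer-A inputs are all in the tree, its proof needs pseudolocality + local
compactness of pointed flows + shrinker rigidity), the 𝔽-precompactness theorem of 2020b (`stub_FCompactness` = the
typed fact `bamler_FCompactness_ricciFlow`, Cor 7.5/Thm 7.4 over `ricciFlowMetricFlowPair`/`fDist`), and the structure
theory export of 2020b §8–9 + 2020c (`stub_structureExport` : the two facts ⇒ N1; this remains route-sized). -/

/-- **Stub 2a** — Bamler 2020a Thm 10.2 (ε-regularity), the typed named fact `bamler_epsilonRegularity` (no `_holds`).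
[cite: Bamler2020Entropy, §10.1 Thm 10.2] -/
theorem stub_epsilonRegularity : bamler_epsilonRegularity := by
  sorry

/-- **Stub 2b-L** (r12: CLOSED — p170080 construction `exists_limitPair_of_chain` + p170118 `limit_fConvergesWithin_of_limitPair`; Theorems record p170240) — Bamler 2023 §5.4 Lemma 5.20 (arXiv v1 Lemma 121): LIMIT WITHIN A CORRESPONDENCE — a sequence of
`H`-concentrated metric flow pairs that is Cauchy within one correspondence with complete separable comparison spaces, uniformly
over `J`, has an `H`-concentrated limit pair to which it `𝔽`-converges within an extension of the correspondence. This is the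
lead's registered helper stub `exists_limit_fConvergesWithin_of_cauchy` VERBATIM (universe 0); all its leaves are landed
(Lemma 29 p165297, Claims 5.21/5.22 p164174 p165324 p163996 p166962 p168481, toolkits p164440 p167167); the assembly is wave 4.
[cite: Bamler2023, §5.4, Lemma 5.20 (arXiv v1 Lemma 121)] -/
theorem stub_limitWithin :
    ∀ {I₀ : Set ℝ} {H : ℝ}, 0 ≤ H → ∀ (P : ℕ → MetricFlowPair.{0} I₀),
      (∀ n, (P n).flow.IsHConcentrated H) →
      ∀ (ℭ : MetricFlow.FamilyCorrespondence (fun n ↦ (P n).flow) I₀),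
      (∀ t, CompleteSpace (ℭ.Z t)) → (∀ t, TopologicalSpace.SeparableSpace (ℭ.Z t)) →
      ∀ {J : Set ℝ}, ℭ.FullyDefinedOver J →
      (∀ ε : ENNReal, 0 < ε → ∃ N, ∀ i ≥ N, ∀ j ≥ N, MetricFlowPair.fDistWithinFamily P ℭ i j J ≤ ε) →
      ∃ (Pinf : MetricFlowPair.{0} I₀)
        (ℭ' : MetricFlow.FamilyCorrespondence (fun o : Option ℕ ↦ (o.elim Pinf P).flow) I₀),
        Pinf.flow.IsHConcentrated H ∧ Pinf.FullyDefinedOver J ∧ MeasurableSet (I₀ \ Pinf.I') ∧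
        ℭ'.FullyDefinedOver J ∧ MetricFlowPair.FConvergesWithin P Pinf ℭ' J :=
  fun hH P hP ℭ hZc hZs _ hJ hC ↦
    MetricFlowPair.limit_fConvergesWithin_of_limitPair MetricFlowPair.exists_limitPair_of_chain
      hH P hP ℭ hZc hZs hJ hC

/-- **Stub 2b-TB** (r11: CLOSED) — TOTAL BOUNDEDNESS half of Bamler 2023 Thm 7.4 (§7.3, arXiv v1 Lemmas 160–165), `J = ∅`,
for `H`-concentrated metric flow pairs over `[a, T]` defined over `(a, T)` with uniformly bounded variances AND COMPACT
time-slices (true for Ricci flows): for every `ε > 0` a subsequence all of whose mutual `d_𝔽`-distances are `≤ ε`. PROVED by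
composition of the landed bricks: Claim 162 `exists_subseq_tendsto_map_kernel` (p168498) ⇒ Lemma 161
`exists_subseq_familyCorrespondence_finite` (p168620) ⇒ Lemmas 164/165 + Thm 7.4 `totalBoundedness_of_finite_subconvergence`
(p168499; uses Lemma 160 p166123 and the selection lemma p162623).
[cite: Bamler2023, §7.3, proof of Thm 7.4; Lemmas 7.? (arXiv v1 160, 161, 164, 165)] -/
theorem stub_totalBoundedness :
    ∀ (H C a T : ℝ), 0 ≤ H → a < T → ∀ P : ℕ → MetricFlowPair.{0} (Set.Icc a T),
      (∀ n, (P n).flow.IsHConcentrated H) → (∀ n, Set.Ioo a T ⊆ (P n).I') →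
      (∀ n (t : (P n).I'), variance ((P n).μ t) ((P n).μ t) ≤ ENNReal.ofReal C) →
      (∀ n (t : (P n).I'), CompactSpace ((P n).flow.Slice t)) →
      ∀ ε : ℝ≥0∞, 0 < ε → ∃ φ : ℕ → ℕ, StrictMono φ ∧
        ∀ i j, MetricFlowPair.fDist ∅ (P (φ i)) (P (φ j)) ≤ ε :=
  fun H C a T hH haT P hP hI hvar hcpt ε hε ↦
    MetricFlowPair.totalBoundedness_of_finite_subconvergence
      (fun hH' hV' P' hP' hI' hvar' hcpt' I₀ hI₀ ↦
        MetricFlowPair.exists_subseq_familyCorrespondence_finite exists_subseq_tendsto_map_kernel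
          hH' hV' P' hP' hI' hvar' hcpt' I₀ hI₀)
      H C a T hH haT P hP hI hvar hcpt ε hε

/-- **Stub 2b-CP** (r11) — COMPLETENESS (Bamler 2023 §5.4 Thm 5.19 / arXiv v1 Thm 120 with the closedness of
`H`-concentration, arXiv Lemma 166), `J = ∅`: a `d_𝔽`-fast-Cauchy sequence of `H`-concentrated pairs over `[a, T]` with
measurable exceptional sets converges in `d_𝔽` to an `H`-concentrated pair. DERIVED (p167054 `completeness_of_limitWithin`)
from the one remaining registered stub of this milestone, Lemma 5.20 `stub_limitWithin` below.
[cite: Bamler2023, §5.4, Thm 5.19, Lemma 5.20; §7.3 Lemma 7.? (arXiv 166)] -/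
theorem stub_completeness :
    ∀ (H a T : ℝ), 0 ≤ H → a < T → ∀ P : ℕ → MetricFlowPair.{0} (Set.Icc a T),
      (∀ n, (P n).flow.IsHConcentrated H) → (∀ n, MeasurableSet (Set.Icc a T \ (P n).I')) →
      (∀ n, MetricFlowPair.fDist ∅ (P n) (P (n + 1)) < 2⁻¹ ^ n) →
      ∃ Pinf : MetricFlowPair.{0} (Set.Icc a T), Pinf.flow.IsHConcentrated H ∧
        MeasurableSet (Set.Icc a T \ Pinf.I') ∧
        Tendsto (fun n ↦ MetricFlowPair.fDist ∅ (P n) Pinf) atTop (𝓝 0) :=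
  completeness_of_limitWithin stub_limitWithin

/-- **Stub 2b, DERIVED (r11)** — Bamler 2023 Cor 7.5 / Thm 7.4 / Lemma 7.3 (𝔽-precompactness of compact Ricci flows with
conjugate heat kernels), the typed named fact `bamler_FCompactness_ricciFlow`, PROVED from 2b-TB (closed) and 2b-CP by the landed
assembly `bamler_FCompactness_ricciFlow_of_totallyBounded_compact_of_complete` (p167089: Lemma 7.3 inputs for Ricci flows, compact
slices = the closed manifold, + the complete/totally-bounded diagonal argument of p162151).
[cite: Bamler2023, §7.1 Cor 7.5; §7.3 proof of Thm 7.4] -/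
theorem stub_FCompactness : bamler_FCompactness_ricciFlow :=
  bamler_FCompactness_ricciFlow_of_totallyBounded_compact_of_complete stub_totalBoundedness stub_completeness

/-- **Stub 2c** — the structure-theory export: Bamler 2020b §6, §8–9 (convergence within a correspondence, smooth
convergence on the regular part) and 2020c Thms 2.4, 2.9, 2.16, 2.40, 2.46 (n = 4), reading off (E1)–(E7) of N1 from an
𝔽-limit (stub 2b) whose flatness alternative is excluded by ε-regularity (stub 2a). Route-sized; see N1-STATUS.md D7.
[cite: Bamler2020Structure, Thm 4, 9, 15, 29, 35] [cite: Bamler2023, §6, §9] -/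
theorem stub_structureExport :
    bamler_epsilonRegularity → bamler_FCompactness_ricciFlow → bamler_orbifoldTangentFlowAtInfinity_four := by
  sorry

/-! ## Former Stub 2 — Bamler's tangent flow at `-∞` (smooth export) = N1 verbatim, now DERIVED from stubs 2a–2c -/

/-- **Former Stub 2 (derived in r9)** — Bamler's orbifold tangent flow at `-∞` (smooth export) = the named fact
`Literature.Geometry.Riemannian.bamler_orbifoldTangentFlowAtInfinity_four` VERBATIM (no `_holds` in the tree: metric flows,
𝔽-convergence, conjugate heat kernels / Nash entropy, metric solitons and the regular–singular decomposition are absent).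
[cite: Bamler2020Structure, Thm 4, 9, 15, 29, 35] [cite: Bamler2020Entropy, §5 Prop 5.2; §10 Thm 10.1] -/
theorem orbifoldTangentFlow_of_stubs :
    ∀ (M : Type) [TopologicalSpace M] [T2Space M] [SecondCountableTopology M]
      [ChartedSpace (EuclideanSpace ℝ (Fin 4)) M] [IsManifold (𝓡 4) ∞ M] [CompactSpace M]
      [ConnectedSpace M] [T3Space M] [MeasurableSpace M] [BorelSpace M]
      (A : ℕ → ℝ)
      (gk : ℕ → ℝ → PseudoRiemannianMetric (𝓡 4) ∞ (EuclideanSpace ℝ (Fin 4)) (TangentSpace (𝓡 4) : M → Type _))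
      (covk : ℕ → ℝ → CovariantDerivative (𝓡 4) (EuclideanSpace ℝ (Fin 4)) (TangentSpace (𝓡 4) : M → Type _))
      (xk : ℕ → M) (F c : ℝ), 0 < c →
      (∀ k : ℕ, (k : ℝ) ≤ A k) →
      (∀ k, IsRicciFlow (gk k) (covk k) (Set.Icc (-(A k)) 0)) →
      (∀ k, ∀ t ∈ Set.Icc (-(A k)) 0, (gk k t).IsRiemannian) →
      (∀ k, ∀ t ∈ Set.Icc (-(A k)) 0, CurvatureBoundedBy (gk k t) (covk k t) 1) →
      (∀ k, ∃ X Y Z W : TangentSpace (𝓡 4) (xk k),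
        (gk k 0).val (xk k) X X ≤ 1 ∧ (gk k 0).val (xk k) Y Y ≤ 1 ∧
        (gk k 0).val (xk k) Z Z ≤ 1 ∧ (gk k 0).val (xk k) W W ≤ 1 ∧
        c ≤ |(gk k 0).curvatureForm (covk k 0) (xk k) X Y Z W|) →
      (∀ k, ∀ t ∈ Set.Icc (-(A k)) 0, ∀ τ : ℝ, 0 < τ → ((F : ℝ) : EReal) ≤ (gk k t).muEntropy (covk k t) τ) →
      ∃ (S : Type) (_ : TopologicalSpace S) (_ : T2Space S) (_ : SecondCountableTopology S)
        (_ : ChartedSpace (EuclideanSpace ℝ (Fin 4)) S) (_ : IsManifold (𝓡 4) ∞ S)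
        (_ : T3Space S) (_ : MeasurableSpace S) (_ : BorelSpace S)
        (gS : PseudoRiemannianMetric (𝓡 4) ∞ (EuclideanSpace ℝ (Fin 4)) (TangentSpace (𝓡 4) : S → Type _))
        (_ : gS.HasLeviCivita) (f : S → ℝ) (hS : gS.IsRiemannian) (W : ℝ)
        -- cone data: index type, sheet numbers, chart radii, scalar-curvature bounds, orbifold chart metrics
        (ι : Type) (kc : ι → ℕ) (rc Λc : ι → ℝ)
        (gc : ι → EuclideanSpace ℝ (Fin 4) →
          (EuclideanSpace ℝ (Fin 4) →L[ℝ] EuclideanSpace ℝ (Fin 4) →L[ℝ] ℝ)),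
        -- (E1) soliton identities in Bamler's normalisation (2020c Thm 15 at τ = 1)
        ContMDiff (𝓡 4) 𝓘(ℝ, ℝ) ∞ f ∧
        (∀ (x : S) (X Y : TangentSpace (𝓡 4) x),
          gS.ricci x X Y + gS.hessian f x X Y = (1 / 2 : ℝ) * gS.val x X Y) ∧
        (∀ x : S, gS.scalarCurvature x + gS.gradSq f x = f x - W) ∧
        -- (E2) `(4π)⁻² e^{-f} dg` is a probability measure on the regular part (μ(𝒮_X) = 0)
        ∫⁻ x, ENNReal.ofReal (Real.exp (-f x))
            ∂(riemannianMeasure (gS.toContMDiffRiemannianMetric hS)) =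
          ENNReal.ofReal (16 * Real.pi ^ 2) ∧
        -- (E3) entropy: the floor passes to `W = 𝒩_𝒳(∞)`; the anchor makes the limit non-flat
        F ≤ W ∧ W < 0 ∧
        -- (E4) Thm 15/35 dichotomy: positive scalar curvature, or a cone point
        ((∀ x : S, 0 < gS.scalarCurvature x) ∨ Nonempty ι) ∧
        -- (E5) orbifold chart metrics at the cone points, Euclidean at the vertex
        (∀ i, 2 ≤ kc i ∧ 0 < rc i ∧ 0 ≤ Λc i ∧
          ContDiffOn ℝ ∞ (gc i) (Metric.ball 0 (rc i)) ∧
          (∀ v w : EuclideanSpace ℝ (Fin 4), gc i 0 v w = inner ℝ v w) ∧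
          (∀ y ∈ Metric.ball (0 : EuclideanSpace ℝ (Fin 4)) (rc i), ∀ v w, gc i y v w = gc i y w v) ∧
          (∀ y ∈ Metric.ball (0 : EuclideanSpace ℝ (Fin 4)) (rc i), ∀ v, v ≠ 0 → 0 < gc i y v v)) ∧
        -- (E6a) transplants of compact sub-annuli of the punctured cone charts into rescaled slices of the
        -- given compact flows (smooth convergence on the regular part, 2020c Thm 4), `k`-sheeted with the
        -- descent `ρ` of `|y|²`, (1±η)-isometric, with scalar curvature control
        (∀ i, ∀ ε η : ℝ, 0 < ε → ε < rc i → 0 < η →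
          ∃ (k : ℕ) (t : ℝ) (_ : t ∈ Set.Icc (-(A k)) 0) (Q : ℝ) (_ : 0 < Q)
            (Φ : EuclideanSpace ℝ (Fin 4) → M) (ρ : M → ℝ),
            ContMDiffOn (𝓡 4) (𝓡 4) ∞ Φ (Metric.ball 0 (rc i) \ Metric.closedBall 0 ε) ∧
            IsOpen (Φ '' (Metric.ball 0 (rc i) \ Metric.closedBall 0 ε)) ∧
            (∀ y ∈ Metric.ball (0 : EuclideanSpace ℝ (Fin 4)) (rc i) \ Metric.closedBall 0 ε,
              Function.Injective (mfderiv (𝓡 4) (𝓡 4) Φ y)) ∧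
            (∀ y ∈ Metric.ball (0 : EuclideanSpace ℝ (Fin 4)) (rc i) \ Metric.closedBall 0 ε,
              (Φ ⁻¹' {Φ y} ∩ (Metric.ball 0 (rc i) \ Metric.closedBall 0 ε)).ncard = kc i) ∧
            ContMDiffOn (𝓡 4) 𝓘(ℝ, ℝ) ∞ ρ (Φ '' (Metric.ball 0 (rc i) \ Metric.closedBall 0 ε)) ∧
            (∀ y ∈ Metric.ball (0 : EuclideanSpace ℝ (Fin 4)) (rc i) \ Metric.closedBall 0 ε,
              ρ (Φ y) = ‖y‖ ^ 2) ∧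
            (∀ y ∈ Metric.ball (0 : EuclideanSpace ℝ (Fin 4)) (rc i) \ Metric.closedBall 0 ε,
              ∀ v : EuclideanSpace ℝ (Fin 4),
                (1 - η) * gc i y v v ≤
                  Q * (gk k t).val (Φ y) (mfderiv (𝓡 4) (𝓡 4) Φ y v) (mfderiv (𝓡 4) (𝓡 4) Φ y v) ∧
                Q * (gk k t).val (Φ y) (mfderiv (𝓡 4) (𝓡 4) Φ y v) (mfderiv (𝓡 4) (𝓡 4) Φ y v) ≤
                  (1 + η) * gc i y v v) ∧
            (∀ y ∈ Metric.ball (0 : EuclideanSpace ℝ (Fin 4)) (rc i) \ Metric.closedBall 0 ε,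
              |(gk k t).scalarCurvatureWith (covk k t) (Φ y)| ≤ Q * Λc i)) ∧
        -- (E6b, E7) no cone point: connected, complete, and compact ⇒ injective immersion into `M` (Thm 4)
        (IsEmpty ι → ConnectedSpace S) ∧
        (IsEmpty ι → ∀ (x : S) (r : NNReal), IsCompact {y : S | gS.edist hS x y ≤ r}) ∧
        (IsEmpty ι → CompactSpace S → ∃ φ : S → M, ContMDiff (𝓡 4) (𝓡 4) ∞ φ ∧ Function.Injective φ ∧
          ∀ x : S, Function.Injective (mfderiv (𝓡 4) (𝓡 4) φ x)) :=
  stub_structureExport stub_epsilonRegularity stub_FCompactness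

/-- The derived Stub 2 IS the named fact N1 (definitional unfolding). [cite: Bamler2020Structure, Thm 4, 9, 15, 29, 35] -/
theorem bamlerFact_of_stub : bamler_orbifoldTangentFlowAtInfinity_four := orbifoldTangentFlow_of_stubs

/-! ## Stubs 2b–7 (renormalisation, cone-exclusion kit, lead glue) and Stub 3 (compact models): ALL CLOSED in the tree.
The blow-down in the route's currency is `RecognitionOfShrinkerGaps.blowdown_of` (p91718) run on Stub 2. -/

/-- **The r2/r3 `stub_blowdown`, DERIVED** from Stub 2 through the landed assembly
`RecognitionOfShrinkerGaps.blowdown_of` (cone exclusion `coneCore` p86535 + `stub_renormalise` p74584). [folklore] -/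
theorem blowdown_of :
    ∀ (M : Type) [TopologicalSpace M] [T2Space M] [SecondCountableTopology M]
      [ChartedSpace (EuclideanSpace ℝ (Fin 4)) M] [IsManifold (𝓡 4) ∞ M] [CompactSpace M]
      [ConnectedSpace M] [T3Space M] [MeasurableSpace M] [BorelSpace M]
      (A : ℕ → ℝ)
      (gk : ℕ → ℝ → PseudoRiemannianMetric (𝓡 4) ∞ (EuclideanSpace ℝ (Fin 4)) (TangentSpace (𝓡 4) : M → Type _))
      (covk : ℕ → ℝ → CovariantDerivative (𝓡 4) (EuclideanSpace ℝ (Fin 4)) (TangentSpace (𝓡 4) : M → Type _))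
      (xk : ℕ → M) (δ' c : ℝ), 0 < δ' → 0 < c →
      (∀ k : ℕ, (k : ℝ) ≤ A k) →
      (∀ k, IsRicciFlow (gk k) (covk k) (Set.Icc (-(A k)) 0)) →
      (∀ k, ∀ t ∈ Set.Icc (-(A k)) 0, (gk k t).IsRiemannian) →
      (∀ k, ∀ t ∈ Set.Icc (-(A k)) 0, CurvatureBoundedBy (gk k t) (covk k t) 1) →
      (∀ k, ∃ X Y Z W : TangentSpace (𝓡 4) (xk k),
        (gk k 0).val (xk k) X X ≤ 1 ∧ (gk k 0).val (xk k) Y Y ≤ 1 ∧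
        (gk k 0).val (xk k) Z Z ≤ 1 ∧ (gk k 0).val (xk k) W W ≤ 1 ∧
        c ≤ |(gk k 0).curvatureForm (covk k 0) (xk k) X Y Z W|) →
      (∀ k, ∀ t ∈ Set.Icc (-(A k)) 0, ∀ τ : ℝ, 0 < τ →
        ((Real.log 2 + Real.log Real.pi / 2 - 3 / 2 + δ' : ℝ) : EReal) ≤
          (gk k t).muEntropy (covk k t) τ) →
      ∃ (S : Type) (_ : TopologicalSpace S) (_ : T2Space S) (_ : SecondCountableTopology S)
        (_ : ChartedSpace (EuclideanSpace ℝ (Fin 4)) S) (_ : IsManifold (𝓡 4) ∞ S) (_ : ConnectedSpace S)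
        (_ : T3Space S) (_ : MeasurableSpace S) (_ : BorelSpace S)
        (gS : PseudoRiemannianMetric (𝓡 4) ∞ (EuclideanSpace ℝ (Fin 4)) (TangentSpace (𝓡 4) : S → Type _))
        (_ : gS.HasLeviCivita) (fS : S → ℝ) (hS : gS.IsRiemannian),
        (∀ (x : S) (r : NNReal), IsCompact {y : S | gS.edist hS x y ≤ r}) ∧
        ContMDiff (𝓡 4) 𝓘(ℝ, ℝ) ∞ fS ∧
        (∀ (x : S) (X Y : TangentSpace (𝓡 4) x),
          gS.ricci x X Y + gS.hessian fS x X Y = (1 / 2 : ℝ) * gS.val x X Y) ∧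
        (∀ x : S, gS.scalarCurvature x + gS.gradSq fS x = fS x) ∧
        (∃ x : S, gS.scalarCurvature x ≠ 0) ∧
        ENNReal.ofReal (32 * Real.pi ^ 2 * Real.sqrt Real.pi * Real.exp (-(3 : ℝ) / 2)) <
          ∫⁻ x, ENNReal.ofReal (Real.exp (-fS x))
            ∂(riemannianMeasure (gS.toContMDiffRiemannianMetric hS)) ∧
        (CompactSpace S → ∃ φ : S → M, ContMDiff (𝓡 4) (𝓡 4) ∞ φ ∧ Function.Injective φ ∧
          ∀ x : S, Function.Injective (mfderiv (𝓡 4) (𝓡 4) φ x)) :=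
  _root_.Summit.SmoothPoincare4.SmoothPoincare4.Theorems.RecognitionOfShrinkerGaps.blowdown_of bamlerFact_of_stub

/-! ## Composition — the crux from the stubs and its two declared route dependencies -/

/-- **The blow-up sequence** (the planner's round-1 `stub_blowupSequence`, DERIVED, sorry-free and now fact-free:
`stub_singularFlow` r8, `stub_pointPicking` p71490, `stub_rescaledSequence` p71836). [folklore] -/
theorem blowupSequence_of :
    ∀ (M : Type) [TopologicalSpace M] [T2Space M] [SecondCountableTopology M]
      [ChartedSpace (EuclideanSpace ℝ (Fin 4)) M] [IsManifold (𝓡 4) ∞ M] [CompactSpace M]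
      [ConnectedSpace M] [T3Space M] [MeasurableSpace M] [BorelSpace M]
      (g : PseudoRiemannianMetric (𝓡 4) ∞ (EuclideanSpace ℝ (Fin 4)) (TangentSpace (𝓡 4) : M → Type _))
      [g.HasLeviCivita] (hg : g.IsRiemannian),
      (∀ x : M, 0 < g.scalarCurvature x) →
      (∃ δ : ℝ, 0 < δ ∧ ∀ τ : ℝ, 0 < τ → ∀ f : M → ℝ, ContMDiff (𝓡 4) 𝓘(ℝ, ℝ) ∞ f →
        ∫ x, (4 * Real.pi * τ) ^ (-(4 : ℝ) / 2) * Real.exp (-f x)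
          ∂(riemannianMeasure (g.toContMDiffRiemannianMetric hg)) = 1 →
        Real.log 2 + Real.log Real.pi / 2 - 3 / 2 + δ ≤
          ∫ x, (τ * (g.scalarCurvature x + g.gradSq f x) + f x - 4) *
            ((4 * Real.pi * τ) ^ (-(4 : ℝ) / 2) * Real.exp (-f x))
            ∂(riemannianMeasure (g.toContMDiffRiemannianMetric hg))) →
      ∃ (κ δ' c : ℝ), 0 < κ ∧ 0 < δ' ∧ 0 < c ∧
        ∃ (A : ℕ → ℝ)
          (gk : ℕ → ℝ → PseudoRiemannianMetric (𝓡 4) ∞ (EuclideanSpace ℝ (Fin 4)) (TangentSpace (𝓡 4) : M → Type _))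
          (covk : ℕ → ℝ → CovariantDerivative (𝓡 4) (EuclideanSpace ℝ (Fin 4)) (TangentSpace (𝓡 4) : M → Type _))
          (xk : ℕ → M),
          (∀ k : ℕ, (k : ℝ) ≤ A k) ∧
          (∀ k, IsRicciFlow (gk k) (covk k) (Set.Icc (-(A k)) 0)) ∧
          (∀ k, ∀ t ∈ Set.Icc (-(A k)) 0, (gk k t).IsRiemannian) ∧
          (∀ k, ∀ t ∈ Set.Icc (-(A k)) 0, CurvatureBoundedBy (gk k t) (covk k t) 1) ∧
          (∀ k, ∃ X Y Z W : TangentSpace (𝓡 4) (xk k),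
            (gk k 0).val (xk k) X X ≤ 1 ∧ (gk k 0).val (xk k) Y Y ≤ 1 ∧
            (gk k 0).val (xk k) Z Z ≤ 1 ∧ (gk k 0).val (xk k) W W ≤ 1 ∧
            c ≤ |(gk k 0).curvatureForm (covk k 0) (xk k) X Y Z W|) ∧
          (∀ k, ∀ r₀ : ℝ, 0 < r₀ → r₀ < Real.sqrt (A k) →
            IsKappaNoncollapsed (gk k) (covk k) (Set.Icc (-(A k)) 0) κ r₀) ∧
          (∀ k, ∀ t ∈ Set.Icc (-(A k)) 0, ∀ τ : ℝ, 0 < τ →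
            ((Real.log 2 + Real.log Real.pi / 2 - 3 / 2 + δ' : ℝ) : EReal) ≤
              (gk k t).muEntropy (covk k t) τ) := by
  intro M _ _ _ _ _ _ _ _ _ _ g _ hg hR hν
  obtain ⟨δ, hδ, hfloor⟩ := hν
  -- Stub 1a: the singular flow with blow-up, NLC and the floor (closed)
  obtain ⟨T, κ, hκ, gt, cov, hmax, _h0, hblow, hnc, hfl⟩ :=
    stub_singularFlow M g hg hR δ hδ hfloor
  -- Stub 1b: point picking
  obtain ⟨tk, Qk, xk, htk, hQk, hA, hbd, hpick⟩ :=
    _root_.Summit.SmoothPoincare4.SmoothPoincare4.Theorems.SubcylindricalRecognition.AncientSphereRigidity.stub_pointPicking M T gt cov hmax hblow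
  -- Stub 1c: rescaling
  exact _root_.Summit.SmoothPoincare4.SmoothPoincare4.Theorems.SubcylindricalRecognition.AncientSphereRigidity.stub_rescaledSequence M T δ κ hδ hκ gt cov hmax hnc hfl
    tk Qk xk htk hQk hA hbd hpick

/-- **RUNG from the line.** `SubcylindricalRecognition` (stmt-SmoothPoincare4-10869) follows from the registered stubs
and the route's two density gaps `NoncompactShrinkerGap` (stmt-…-10868) and `CompactShrinkerGap` (stmt-…-10870) — the
crux's declared dependencies, taken as hypotheses BY NAME. Blow up (`blowupSequence_of`) and blow down (`blowdown_of`);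
a non-compact blow-down contradicts `NoncompactShrinkerGap` (Gaussian mass `> Θ_cyl·16π²` versus `≤`); a compact one
immerses injectively into the connected `M`, hence (`stub_compactModelRecognition`) is diffeomorphic to `M ≃ₕ S⁴`, so it
is a compact shrinker on a homotopy 4-sphere of density `> Θ_cyl`, and `CompactShrinkerGap` returns its diffeomorphism to
`S⁴`. The homotopy equivalence is used twice, as `Disproof.recognitionWithoutHomotopyEquiv_false` demands. -/
theorem SubcylindricalRecognition_of
    (h₂ : _root_.Summit.SmoothPoincare4.SmoothPoincare4.Theses.EntropyRung.NoncompactShrinkerGap)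
    (h₄ : _root_.Summit.SmoothPoincare4.SmoothPoincare4.Theses.EntropyRung.CompactShrinkerGap) :
    _root_.Summit.SmoothPoincare4.SmoothPoincare4.Theses.EntropyRung.SubcylindricalRecognition := by
  intro M _ _ _ _ _ _ _ _ _ e g _ hg hR hν
  -- `M ≃ₕ S⁴` ⇒ `M` (path) connected
  haveI : PathConnectedSpace (Metric.sphere (0 : EuclideanSpace ℝ (Fin 5)) 1) :=
    Literature.Topology.FourManifolds.pathConnectedSpace_sphere_four
  haveI : PathConnectedSpace M :=
    Literature.Topology.FourManifolds.pathConnectedSpace_of_homotopyEquiv e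
  -- Stubs 1a–1c: the blow-up sequence of rescaled flows on `M`
  obtain ⟨κ, δ', c, _hκ, hδ', hc, A, gk, covk, xk, hA, hflow, hRiem, hcurv, hpt, _hnc, hfloor⟩ :=
    blowupSequence_of M g hg hR hν
  -- Stub 2 and the landed kit: its blow-down shrinker `S`
  obtain ⟨S, _, _, _, _, _, _, _, _, _, gS, _, fS, hS, hScomplete, hfS, hsol, hnorm, hSnonflat, hdens,
      hScouple⟩ :=
    blowdown_of M A gk covk xk δ' c hδ' hc hA hflow hRiem hcurv hpt hfloor
  by_cases hSc : CompactSpace S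
  · -- compact blow-down: `S` immerses injectively into `M`, hence `S ≅ M ≃ₕ S⁴` (Stub 3),
    -- and `CompactShrinkerGap` applies to `S`
    obtain ⟨φ, hφ, hφinj, hφimm⟩ := hScouple hSc
    obtain ⟨eSM⟩ := _root_.Summit.SmoothPoincare4.SmoothPoincare4.Theorems.SubcylindricalRecognition.AncientSphereRigidity.stub_compactModelRecognition S M φ hφ hφinj hφimm
    have eS4 : S ≃ₕ Metric.sphere (0 : EuclideanSpace ℝ (Fin 5)) 1 :=
      eSM.toHomeomorph.toHomotopyEquiv.trans e
    obtain ⟨eS⟩ := h₄ S eS4 gS fS hS hfS hsol hnorm hdens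
    exact ⟨eSM.symm.trans eS⟩
  · -- non-compact blow-down: forbidden by `NoncompactShrinkerGap`
    haveI : NoncompactSpace S := not_compactSpace_iff.mp hSc
    have hle := h₂ S gS fS hS hScomplete hfS hsol hnorm hSnonflat
    exact absurd hdens (not_lt.mpr hle)

/-- The same composition through the landed Theorems-side assembly, as a cross-check (conditional on Stub 2 only).
[folklore] -/
theorem SubcylindricalRecognition_of'
    (h₂ : _root_.Summit.SmoothPoincare4.SmoothPoincare4.Theses.EntropyRung.NoncompactShrinkerGap)
    (h₄ : _root_.Summit.SmoothPoincare4.SmoothPoincare4.Theses.EntropyRung.CompactShrinkerGap) :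
    _root_.Summit.SmoothPoincare4.SmoothPoincare4.Theses.EntropyRung.SubcylindricalRecognition :=
  _root_.Summit.SmoothPoincare4.SmoothPoincare4.Theorems.RecognitionOfShrinkerGaps.subcylindricalRecognition_of_facts
    ricciFlow_shortTime_existence_holds perelman_muEntropy_monotone_holds bamlerFact_of_stub h₂ h₄

end Summit.SmoothPoincare4.SmoothPoincare4.Cruxes.SubcylindricalRecognition.AncientSphereRigidity

end
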